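import Literature.NumberTheory.DiophantineGeometry.GenEllMell
import HarnessLib

/-!
# [GenEll] §3: a local height is at most `[F:ℚ]·deg_∞ / log 2`

S. Mochizuki, *Arithmetic elliptic curves in general position*, Math. J. Okayama Univ. **52** (2010),
proof of Lemma 3.7, first sentence, p. 18 [cite: MochizukiGenEll2010, Lem 3.7 p.18]:

> First, observe that if `v` is any local height of `E_L`, then `d · deg_∞([E_L]) ≥ v · log(2)`.

(`d = [L:ℚ]`; also used in [IUTchIV] Cor. 2.2, p. 44, in the form `h_v·f_v·log(p_v) ≤ [F:ℚ]·h`.)  In the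
tree's rendering (`GenEllMell.lean`): `deg_∞(P) = [F:ℚ]⁻¹·log N(𝔇_j)` (`EllPoint.degInf`, `𝔇_j` the
denominator ideal of `j`) and the local height at `v` is `−ord_v(j)` (`EllPoint.localHeight`).  PROVED
here: `𝔇_j ⊆ 𝔭_v^{h_v}` (`jDenominatorIdeal_le_pow_localHeight`: `a·j ∈ 𝓞` forces `ord_v(a) ≥ −ord_v(j)`),
hence `N(𝔭_v)^{h_v} ∣ N(𝔇_j)`, `2^{h_v} ≤ N(𝔇_j)` and `h_v · log 2 ≤ [F:ℚ] · deg_∞`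
(`localHeight_mul_log_two_le`); also `0 ≤ deg_∞` (`degInf_nonneg`).  Proof-only; no definitions.
-/

noncomputable section

namespace Literature.NumberTheory.DiophantineGeometry.GenEll

open NumberField IsDedekindDomain Literature.IUT.LogVolume

namespace EllPoint

variable (P : EllPoint)

/-- `deg_∞ ≥ 0` (the denominator ideal is a non-zero integral ideal, so its norm is `≥ 1`).
[cite: MochizukiGenEll2010, §3 p.16] -/
theorem degInf_nonneg : 0 ≤ P.degInf := by
  unfold EllPoint.degInf
  refine mul_nonneg (inv_nonneg.mpr (Nat.cast_nonneg _)) (Real.log_nonneg ?_)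
  have h0 : Ideal.absNorm P.W.jDenominatorIdeal ≠ 0 := by
    rw [Ne, Ideal.absNorm_eq_zero_iff]
    exact P.W.jDenominatorIdeal_ne_bot
  exact_mod_cast Nat.one_le_iff_ne_zero.mpr h0

/-- `𝔇_j ⊆ 𝔭_v^{h_v}` with `h_v = −ord_v(j)` the local height (for `h_v ≤ 0` the right side is `𝓞`):
if `a·j ∈ 𝓞_F` then `ord_v(a) ≥ −ord_v(j)`. [cite: MochizukiGenEll2010, Lem 3.7 p.18] -/
theorem jDenominatorIdeal_le_pow_localHeight (v : HeightOneSpectrum (𝓞 P.F)) :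
    P.W.jDenominatorIdeal ≤ v.asIdeal ^ (P.localHeight v).toNat := by
  intro a ha
  by_cases hh : P.localHeight v ≤ 0
  · rw [Int.toNat_of_nonpos hh, pow_zero, Ideal.one_eq_top]
    exact Submodule.mem_top
  push Not at hh
  -- `j ≠ 0` (else its `ord` is the junk value `0`)
  have hj : P.W.j ≠ 0 := by
    intro hj
    simp only [EllPoint.localHeight, hj, ord_zero, neg_zero, lt_self_iff_false] at hh
  by_cases ha0 : a = 0
  · rw [ha0]; exact Submodule.zero_mem _
  have ha0' : (a : P.F) ≠ 0 := by exact_mod_cast ha0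
  obtain ⟨b, hb⟩ := (P.W.mem_jDenominatorIdeal a).mp ha
  -- `ord_v(a) + ord_v(j) = ord_v(b) ≥ 0`
  have hord : -ord P.F v P.W.j ≤ ord P.F v (a : P.F) := by
    have h1 : ord P.F v ((a : P.F) * P.W.j) = ord P.F v (a : P.F) + ord P.F v P.W.j :=
      ord_mul P.F v ha0' hj
    have h2 : 0 ≤ ord P.F v ((a : P.F) * P.W.j) := by rw [hb]; exact ord_nonneg_of_isIntegral P.F v b
    linarith
  have hnat : ((P.localHeight v).toNat : ℤ) = -ord P.F v P.W.j := by
    rw [Int.toNat_of_nonneg hh.le]; rfl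
  -- translate `ord_v(a) ≥ h` into membership in `𝔭_v^h`
  rw [← HeightOneSpectrum.intValuation_le_pow_iff_mem, ← HeightOneSpectrum.valuation_of_algebraMap
    (K := P.F)]
  have hva : v.valuation P.F (a : P.F) ≠ 0 := (v.valuation P.F).ne_zero_iff.mpr ha0'
  rw [← WithZero.log_le_iff_le_exp hva, hnat]
  have hlog : WithZero.log (v.valuation P.F (a : P.F)) = -ord P.F v (a : P.F) := by
    rw [ord, neg_neg]
  rw [hlog]
  linarith

/-- **`h_v · log 2 ≤ [F:ℚ] · deg_∞`** for every finite place `v` ([GenEll] proof of Lemma 3.7: "if `v`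
is any local height of `E_L`, then `d · deg_∞([E_L]) ≥ v · log(2)`"): `N(𝔭_v)^{h_v}` divides
`N(𝔇_j)` and `N(𝔭_v) ≥ 2`. [cite: MochizukiGenEll2010, Lem 3.7 p.18] -/
theorem localHeight_mul_log_two_le (v : HeightOneSpectrum (𝓞 P.F)) :
    (P.localHeight v : ℝ) * Real.log 2 ≤ (P.degree : ℝ) * P.degInf := by
  have hdeg : (P.degree : ℝ) * P.degInf = Real.log (Ideal.absNorm P.W.jDenominatorIdeal) := by
    unfold EllPoint.degInf
    have hd : (P.degree : ℝ) ≠ 0 := by exact_mod_cast P.degree_pos.ne'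
    field_simp
  rw [hdeg]
  by_cases hh : P.localHeight v ≤ 0
  · calc (P.localHeight v : ℝ) * Real.log 2 ≤ 0 :=
          mul_nonpos_of_nonpos_of_nonneg (by exact_mod_cast hh) (Real.log_nonneg (by norm_num))
      _ ≤ Real.log (Ideal.absNorm P.W.jDenominatorIdeal) := by
          have := P.degInf_nonneg
          rw [← hdeg]; exact mul_nonneg (Nat.cast_nonneg _) this
  push Not at hh
  set h : ℕ := (P.localHeight v).toNat with hhdef
  have hcast : (P.localHeight v : ℝ) = (h : ℝ) := by
    have : (P.localHeight v : ℤ) = (h : ℤ) := by rw [hhdef, Int.toNat_of_nonneg hh.le]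
    exact_mod_cast this
  -- `N(𝔭^h) ∣ N(𝔇)` and `N(𝔇) ≠ 0`
  have hdvd : Ideal.absNorm (v.asIdeal ^ h) ∣ Ideal.absNorm P.W.jDenominatorIdeal :=
    Ideal.absNorm_dvd_absNorm_of_le (P.jDenominatorIdeal_le_pow_localHeight v)
  have hD0 : Ideal.absNorm P.W.jDenominatorIdeal ≠ 0 := by
    rw [Ne, Ideal.absNorm_eq_zero_iff]; exact P.W.jDenominatorIdeal_ne_bot
  have hle : Ideal.absNorm (v.asIdeal ^ h) ≤ Ideal.absNorm P.W.jDenominatorIdeal :=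
    Nat.le_of_dvd (Nat.pos_of_ne_zero hD0) hdvd
  rw [map_pow] at hle
  have h2 : 2 ≤ Ideal.absNorm v.asIdeal := NumberField.HeightOneSpectrum.one_lt_absNorm v
  have hpow : (2 : ℕ) ^ h ≤ Ideal.absNorm P.W.jDenominatorIdeal :=
    (Nat.pow_le_pow_left h2 h).trans hle
  have hreal : (2 : ℝ) ^ h ≤ (Ideal.absNorm P.W.jDenominatorIdeal : ℝ) := by exact_mod_cast hpow
  calc (P.localHeight v : ℝ) * Real.log 2 = Real.log ((2 : ℝ) ^ h) := by
        rw [hcast, Real.log_pow]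
    _ ≤ Real.log (Ideal.absNorm P.W.jDenominatorIdeal) :=
        Real.log_le_log (by positivity) hreal

end EllPoint

end Literature.NumberTheory.DiophantineGeometry.GenEll

end
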